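import Summits.PneNP.GCT.Max.KYPaddingTransportCone
import Literature.Computability.AlgebraicComplexity.PolynomialKoszulYoungFlatteningLeadingTerms
import Mathlib.LinearAlgebra.Dimension.OrzechProperty
import HarnessLib
import HarnessLib.Audit

/-!
# `GCT/Max`: the OUTER columns of the Koszul–Young tables are binomial — `KY_{p,0}` and `KY_{p,d-1}` of any form with
# linearly independent first partials; the 9-letter table node `KYCubicsDominance` reduces to its middle column

Cell `pub-gct-max` (HOME `run/shared/lean/pub/pub-gct-max/`), track F, seat lit-2 (gen 6). Companion of
`Max/KYPaddingTransport.lean` (lead D110 (a)/D153/D187: the formal picture of track F reduces C-F-1 and S to the typed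
paper theorem R-F-T2-25 plus ONE table node, `KYCubicsDominance` = "cellwise `rank KY_{p,k}(per₃) ≤ rank KY_{p,k}(det₃)` on
`S³(ℂ⁹)`", certified outside Lean by engine-3: `HOME/flat/KY-CUBICS/exact_det3.json` sha256/16 `04ea63a3e9cf73a7`,
`exact_perm3.json` `7ca41ffc9cd62a0d`, kyflat v0.6 `eaf7ff42f1dd`, two-sided certificates over `ℚ`, 27 + 27 cells; lead D208).

WHAT IS PROVED HERE (no hypotheses, any field unless said).
* `KYOuter.kyRankFin_zero_eq_choose`: if the first partials `∂_0 f, …, ∂_{q-1} f` are linearly independent, then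
  `rank f^{∧p}_{0,d} = C(q,p)` for `p + 1 ≤ q` — the order-`0` Koszul–Young flattening `e_S ↦ ∑_{i∉S} ±∂_i f ⊗ e_{S⊔i}` is
  INJECTIVE (leading-term argument of the tree's `card_le_kyRankFin_of_leading`: order `(p+1)`-subsets by `∑ 2^t`, lead
  `S ↦ S ⊔ max Sᶜ`; the diagonal blocks are `±` distinct first partials) and has `C(q,p)` columns.
* `KYOuter.kyRankFin_top_eq_choose`: for a form of degree `d ≥ 1` in characteristic `0`, `rank f^{∧p}_{d-1,1} = C(q,p+1)`
  (`p + 1 ≤ q`), by the tree's transpose duality `kyRankFin_dual`.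
* Hence for `det_n` and `per_n` (first partials = the size-`(n-1)` minors resp. sub-permanents, linearly independent by the
  tree's `flatteningRank_detPoly/perPoly` at `k = 1`): the columns `k = 0` and `k = n - 1` of BOTH Koszul–Young tables are
  `C(n²,p)` resp. `C(n²,p+1)` — EQUAL for the determinant and the permanent (`KYDetPerOuterColumns`, `…_holds`). For
  `n = 3` these are the 18 + 18 cells `(p,0)`, `(p,2)` of engine-3's exact tables (values `1,9,36,84,126,126,84,36,9` and
  `9,36,84,126,126,84,36,9,1` — reproduced here as THEOREMS), for `n = 4` the columns `(p,0)`, `(p,3)` of the 64-cell tables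
  (where engine-3's exact `per₄ − det₄` difference table is indeed `0`, D208).
* The reduction: `KYCubicsDominance ↔ KYCubicsMiddleColumnDominance` (`CubicsDominanceIffMiddleColumn`, `…_holds`), the
  latter being the `k = 1` column only (9 cells, of which `(4,1)`: `934 ≤ 950` is the one strict cell; an obligation node
  until those certificates are replayed in the kernel — blocks of size `≤ 45` after engine-3's torus-weight blocking).
Placement Summits-side (`GCT/Max/`, naming rule) because the cell statements are not in print; the two general lemmas are
folklore linear algebra (no printed statement located: Guan 2015 Lemma 2.9 treats `x^d`, Thm 2.7 generic catalecticants).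
This file ASSERTS NOTHING beyond what it proves. HONEST FRAMING: multiplicity data and certified rank bounds at small
parameters; occurrence obstructions are ruled out in print (BIP'16) — multiplicity obstructions are the open door; nothing
here is a claim on VP vs VNP or P vs NP.

## References
* engine-3, `HOME/flat/KY-CUBICS/exact_det3.json`, `exact_perm3.json`; `HOME/flat/KY-QUARTICS/exact_det4.j184804.json`,
  `exact_perm4.j184806.json` (FLAT-PLAN T10, HOME INBOX 2026-08-23 l.514; lead D208 l.517).
* [LandsbergGCT2017] §8.2.1 eq. (8.2.1) (the flattening; tree `kyRankFin`), Exercise 6.2.2.7 (partials of `det_n`, `per_n`).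
* [Guan2016] §1.3, Lemma 2.9 (the rank-one value; tree `kyRankFin_X_pow`).
-/

noncomputable section

open MvPolynomial

namespace Summit.PneNP.GCT

open Literature.Computability.AlgebraicComplexity Literature.Barriers.ValiantsHypothesis

namespace KYOuter

/-! ## Order `0`: the Koszul–Young flattening of a form with independent first partials is injective -/

section General

variable {K : Type*} [Field K] {q : ℕ}

/-- Binary position of a subset of `Fin q` (an injective, insertion-monotone linear order on subsets). [folklore] -/
def pos (T : Finset (Fin q)) : ℕ := ∑ t ∈ T, 2 ^ (t : ℕ)

/-- `pos (S ⊔ {j}) = pos S + 2^j` for `j ∉ S`. [folklore] -/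
theorem pos_insert {S : Finset (Fin q)} {j : Fin q} (hj : j ∉ S) :
    pos (insert j S) = pos S + 2 ^ (j : ℕ) := by
  rw [pos, pos, Finset.sum_insert hj, add_comm]

/-- The Koszul sign is `± 1`, hence non-zero in a field. [folklore] -/
theorem koszulSign_cast_ne_zero (S : Finset (Fin q)) (j : Fin q) : (koszulSign S j : K) ≠ 0 := by
  intro h
  have h1 := congrArg (fun z : ℤ => (z : K)) (koszulSign_mul_self S j)
  simp only [Int.cast_mul, Int.cast_one, h, mul_zero] at h1
  exact zero_ne_one h1

/-- At order `k = 0` the Koszul–Young images are indexed by the `p`-subsets alone (`∂^{[]} = id`). [folklore] -/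
theorem kyImages_zero_eq_range (p : ℕ) (f : MvPolynomial (Fin q) K) :
    kyImages p 0 f = Set.range (fun S : PSub q p => kyImage f [] S.1) := by
  ext g
  rw [mem_kyImages_iff, Set.mem_range]
  constructor
  · rintro ⟨l, S, hl, hS, rfl⟩
    rw [List.length_eq_zero_iff] at hl
    subst hl
    exact ⟨⟨S, hS⟩, rfl⟩
  · rintro ⟨S, rfl⟩
    exact ⟨[], S.1, rfl, S.2, rfl⟩

/-- Upper bound `rank f^{∧p}_{0,d} ≤ C(q,p)` (the number of columns). [folklore] -/
theorem kyRankFin_zero_le_choose (p : ℕ) (f : MvPolynomial (Fin q) K) :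
    kyRankFin K p 0 f ≤ q.choose p := by
  have h := finrank_range_le_card (R := K) (fun S : PSub q p => kyImage f [] S.1)
  rw [Fintype.card_finset_len, Fintype.card_fin] at h
  rw [kyRankFin, kyImages_zero_eq_range]
  exact h

/-- **Lower bound `C(q,p) ≤ rank f^{∧p}_{0,d}`** when the first partials of `f` are linearly independent and `p + 1 ≤ q`:
the columns `e_S ↦ ∑_{i ∉ S} ε(S,i) ∂_i f ⊗ e_{S ⊔ i}` are linearly independent (leading position `S ⊔ max Sᶜ` for the
binary order on `(p+1)`-subsets; diagonal blocks `± ∂_j f` with distinct `j`). [folklore] -/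
theorem choose_le_kyRankFin_zero {f : MvPolynomial (Fin q) K}
    (hli : LinearIndependent K (fun i : Fin q => pderiv i f)) (p : ℕ) (hp : p + 1 ≤ q) :
    q.choose p ≤ kyRankFin K p 0 f := by
  classical
  have hne : ∀ S : PSub q p, (S.1ᶜ).Nonempty := by
    intro S
    rw [← Finset.card_pos, Finset.card_compl, Fintype.card_fin, S.2]
    omega
  let jm : PSub q p → Fin q := fun S => (S.1ᶜ).max' (hne S)
  have hjm_not_mem : ∀ S : PSub q p, jm S ∉ S.1 := by
    intro S
    have h := Finset.max'_mem (S.1ᶜ) (hne S)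
    rw [Finset.mem_compl] at h
    exact h
  have hjm_max : ∀ (S : PSub q p) (j : Fin q), j ∉ S.1 → j ≤ jm S := fun S j hj =>
    Finset.le_max' _ j (Finset.mem_compl.2 hj)
  let lead : PSub q p → Finset (Fin q) := fun S => insert (jm S) S.1
  have h := card_le_kyRankFin_of_leading (K := K) f (fun _ : PSub q p => ([] : List (Fin q))) (fun S => S.1)
    (fun _ => rfl) (fun S => S.2) lead pos ?hzero ?hdiag
  · rwa [Fintype.card_finset_len, Fintype.card_fin] at h
  case hzero =>
    intro S T hT hle
    refine kyImage_apply_eq_zero f [] S.1 T fun j hj hTj => ?_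
    apply hT
    rw [hTj]
    have hle' : 2 ^ (jm S : ℕ) ≤ 2 ^ (j : ℕ) := by
      have h' := hle
      rw [hTj, show lead S = insert (jm S) S.1 from rfl, pos_insert (hjm_not_mem S), pos_insert hj] at h'
      omega
    have hjle : jm S ≤ j := by
      rw [Fin.le_iff_val_le_val]
      exact (Nat.pow_le_pow_iff_right (by norm_num)).1 hle'
    show insert j S.1 = insert (jm S) S.1
    rw [le_antisymm hjle (hjm_max S j hj)]
  case hdiag =>
    intro T
    have hinj : Function.Injective (fun S : {S : PSub q p // lead S = T} => jm S.1) := by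
      intro S S' hSS'
      dsimp only at hSS'
      have e1 : S.1.1 = T.erase (jm S.1) := by
        have h3 : (insert (jm S.1) S.1.1).erase (jm S.1) = S.1.1 := Finset.erase_insert (hjm_not_mem S.1)
        have h4 : insert (jm S.1) S.1.1 = T := S.2
        rw [h4] at h3
        exact h3.symm
      have e2 : S'.1.1 = T.erase (jm S'.1) := by
        have h3 : (insert (jm S'.1) S'.1.1).erase (jm S'.1) = S'.1.1 := Finset.erase_insert (hjm_not_mem S'.1)
        have h4 : insert (jm S'.1) S'.1.1 = T := S'.2
        rw [h4] at h3
        exact h3.symm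
      apply Subtype.ext
      apply Subtype.ext
      rw [e1, hSS']
      exact e2.symm
    let w : {S : PSub q p // lead S = T} → Kˣ := fun S =>
      Units.mk0 (koszulSign S.1.1 (jm S.1) : K) (koszulSign_cast_ne_zero S.1.1 (jm S.1))
    have hfun : (fun S : {S : PSub q p // lead S = T} => kyImage f [] S.1.1 T) =
        w • (fun S : {S : PSub q p // lead S = T} => pderiv (jm S.1) f) := by
      funext S
      have hT : T = insert (jm S.1) S.1.1 := S.2.symm
      rw [Pi.smul_apply', congrArg (kyImage f [] S.1.1) hT, kyImage_apply_insert f [] (hjm_not_mem S.1),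
        iterPDeriv_nil, ← map_intCast (C : K →+* MvPolynomial (Fin q) K), C_mul']
      rfl
    show LinearIndependent K (fun S : {S : PSub q p // lead S = T} => kyImage f [] S.1.1 T)
    rw [hfun]
    exact (hli.comp _ hinj).units_smul w

/-- **`rank f^{∧p}_{0,d} = C(q,p)`** for `p + 1 ≤ q` when the first partials of `f` are linearly independent. [folklore] -/
theorem kyRankFin_zero_eq_choose {f : MvPolynomial (Fin q) K}
    (hli : LinearIndependent K (fun i : Fin q => pderiv i f)) (p : ℕ) (hp : p + 1 ≤ q) :
    kyRankFin K p 0 f = q.choose p :=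
  le_antisymm (kyRankFin_zero_le_choose p f) (choose_le_kyRankFin_zero hli p hp)

/-- **`rank f^{∧p}_{d-1,1} = C(q,p+1)`** (`p + 1 ≤ q`) for a form of degree `d ≥ 1` with linearly independent first
partials, in characteristic `0`: transpose duality `rank f^{∧p}_{k,d-k} = rank f^{∧(q-1-p)}_{d-1-k,k+1}` (tree
`kyRankFin_dual`) and `C(q, q-1-p) = C(q, p+1)`. [folklore] -/
theorem kyRankFin_top_eq_choose [CharZero K] {f : MvPolynomial (Fin q) K} {d : ℕ} (hf : f.IsHomogeneous d)
    (hd : 1 ≤ d) (hli : LinearIndependent K (fun i : Fin q => pderiv i f)) (p : ℕ) (hp : p + 1 ≤ q) :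
    kyRankFin K p (d - 1) f = q.choose (p + 1) := by
  rw [kyRankFin_dual hf p (d - 1) hp (by omega), Nat.sub_self,
    kyRankFin_zero_eq_choose hli (q - 1 - p) (by omega), show q - 1 - p = q - (p + 1) by omega,
    Nat.choose_symm (by omega : p + 1 ≤ q)]

end General

/-! ## Numbering-free versions and the transport of "independent first partials" along a renumbering -/

section Rename

variable (K : Type*) [Field K]

/-- Renaming the letters along a bijection preserves linear independence of the first partials. [folklore] -/
theorem linearIndependent_pderiv_rename {σ : Type*} {q : ℕ} {f : MvPolynomial σ K} (e : σ ≃ Fin q)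
    (hli : LinearIndependent K (fun i : σ => pderiv i f)) :
    LinearIndependent K (fun j : Fin q => pderiv j (rename e f)) := by
  have h1 : LinearIndependent K
      (((renameEquiv K e).toLinearEquiv : MvPolynomial σ K →ₗ[K] MvPolynomial (Fin q) K) ∘
        fun i : σ => pderiv i f) :=
    hli.map' _ (LinearEquiv.ker _)
  have h2 := h1.comp e.symm e.symm.injective
  convert h2 using 1
  funext j
  simp only [Function.comp_apply, LinearEquiv.coe_coe, AlgEquiv.toLinearEquiv_apply, renameEquiv_apply]
  conv_lhs => rw [← e.apply_symm_apply j]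
  rw [pderiv_rename e.injective]

/-- `rank F^{∧p}_{0,d} = C(#letters, p)` (`p + 1 ≤ #letters`) for a form with linearly independent first partials,
numbering-free. [folklore] -/
theorem kyRank_zero_eq_choose {σ : Type*} [Fintype σ] [DecidableEq σ] {f : MvPolynomial σ K}
    (hli : LinearIndependent K (fun i : σ => pderiv i f)) (p : ℕ) (hp : p + 1 ≤ Fintype.card σ) :
    kyRank K p 0 f = (Fintype.card σ).choose p := by
  rw [kyRank_def]
  exact kyRankFin_zero_eq_choose (linearIndependent_pderiv_rename K (Fintype.equivFin σ) hli) p hp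

/-- `rank F^{∧p}_{d-1,1} = C(#letters, p+1)` (`p + 1 ≤ #letters`, `d ≥ 1`, characteristic `0`), numbering-free.
[folklore] -/
theorem kyRank_top_eq_choose [CharZero K] {σ : Type*} [Fintype σ] [DecidableEq σ] {f : MvPolynomial σ K} {d : ℕ}
    (hf : f.IsHomogeneous d) (hd : 1 ≤ d) (hli : LinearIndependent K (fun i : σ => pderiv i f)) (p : ℕ)
    (hp : p + 1 ≤ Fintype.card σ) :
    kyRank K p (d - 1) f = (Fintype.card σ).choose (p + 1) := by
  rw [kyRank_def]
  exact kyRankFin_top_eq_choose hf.rename_isHomogeneous hd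
    (linearIndependent_pderiv_rename K (Fintype.equivFin σ) hli) p hp

end Rename

/-! ## The determinant and the permanent: first partials are linearly independent -/

section DetPer

variable (K : Type*) [Field K]

/-- The order-`1` derivative set is the set of first partials. [folklore] -/
theorem derivSet_one_eq_range {σ : Type*} (f : MvPolynomial σ K) :
    derivSet 1 f = Set.range (fun v : σ => pderiv v f) := by
  ext h
  simp only [derivSet, Set.mem_setOf_eq, Set.mem_range]
  constructor
  · rintro ⟨l, hl, rfl⟩
    rcases l with _ | ⟨v, _ | ⟨w, l⟩⟩
    · simp at hl
    · exact ⟨v, by rw [iterPDeriv_cons, iterPDeriv_nil]⟩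
    · simp at hl
  · rintro ⟨v, rfl⟩
    exact ⟨[v], rfl, by rw [iterPDeriv_cons, iterPDeriv_nil]⟩

/-- The `n²` first partials of `det_n` (the signed maximal minors) are linearly independent — the `k = 1` case of the
tree's `rank (det_n)_{k,n-k} = C(n,k)²`. [folklore] -/
theorem linearIndependent_pderiv_detPoly (n : ℕ) :
    LinearIndependent K (fun v : Fin n × Fin n => pderiv v (detPoly (Fin n) K)) := by
  rw [linearIndependent_iff_card_eq_finrank_span, Fintype.card_prod, Fintype.card_fin]
  have h := flatteningRank_detPoly K n 1
  rw [shiftedPartialsRank_zero_eq, derivSet_one_eq_range, Nat.choose_one_right, sq] at h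
  exact h.symm

/-- The `n²` first partials of `per_n` (the maximal sub-permanents) are linearly independent. [folklore] -/
theorem linearIndependent_pderiv_perPoly (n : ℕ) :
    LinearIndependent K (fun v : Fin n × Fin n => pderiv v (perPoly (Fin n) K)) := by
  rw [linearIndependent_iff_card_eq_finrank_span, Fintype.card_prod, Fintype.card_fin]
  have h := flatteningRank_perPoly K n 1
  rw [shiftedPartialsRank_zero_eq, derivSet_one_eq_range, Nat.choose_one_right, sq] at h
  exact h.symm

/-- Column `k = 0` of the Koszul–Young table of `det_n`: `rank = C(n²,p)` (`p + 1 ≤ n²`). [folklore] -/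
theorem kyRank_detPoly_zero (n p : ℕ) (hp : p + 1 ≤ n * n) :
    kyRank K p 0 (detPoly (Fin n) K) = (n * n).choose p := by
  have h := kyRank_zero_eq_choose K (linearIndependent_pderiv_detPoly K n) p (by simpa using hp)
  simpa using h

/-- Column `k = 0` of the Koszul–Young table of `per_n`: `rank = C(n²,p)` (`p + 1 ≤ n²`). [folklore] -/
theorem kyRank_perPoly_zero (n p : ℕ) (hp : p + 1 ≤ n * n) :
    kyRank K p 0 (perPoly (Fin n) K) = (n * n).choose p := by
  have h := kyRank_zero_eq_choose K (linearIndependent_pderiv_perPoly K n) p (by simpa using hp)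
  simpa using h

/-- Column `k = n - 1` of the Koszul–Young table of `det_n`: `rank = C(n²,p+1)` (`p + 1 ≤ n²`, characteristic `0`).
[folklore] -/
theorem kyRank_detPoly_top [CharZero K] (n p : ℕ) (hp : p + 1 ≤ n * n) :
    kyRank K p (n - 1) (detPoly (Fin n) K) = (n * n).choose (p + 1) := by
  have hn : 1 ≤ n := by rcases n with _ | n <;> simp at hp ⊢
  have hdet : (detPoly (Fin n) K).IsHomogeneous n := by
    simpa only [Fintype.card_fin] using (detPoly_isHomogeneous : (detPoly (Fin n) K).IsHomogeneous _)
  have h := kyRank_top_eq_choose K hdet hn (linearIndependent_pderiv_detPoly K n) p (by simpa using hp)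
  simpa using h

/-- Column `k = n - 1` of the Koszul–Young table of `per_n`: `rank = C(n²,p+1)` (`p + 1 ≤ n²`, characteristic `0`).
[folklore] -/
theorem kyRank_perPoly_top [CharZero K] (n p : ℕ) (hp : p + 1 ≤ n * n) :
    kyRank K p (n - 1) (perPoly (Fin n) K) = (n * n).choose (p + 1) := by
  have hn : 1 ≤ n := by rcases n with _ | n <;> simp at hp ⊢
  have hper : (perPoly (Fin n) K).IsHomogeneous n := by
    simpa only [Fintype.card_fin] using (perPoly_isHomogeneous : (perPoly (Fin n) K).IsHomogeneous _)
  have h := kyRank_top_eq_choose K hper hn (linearIndependent_pderiv_perPoly K n) p (by simpa using hp)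
  simpa using h

end DetPer

end KYOuter

/-! ## The typed statements: outer columns agree; `KYCubicsDominance` is its middle column -/

open KYOuter

/-- **Outer Koszul–Young columns of `det_n` and `per_n` agree (all `n`, all `p`)**: `rank KY_{p,0}(per_n) = rank KY_{p,0}(det_n)`
and `rank KY_{p,n-1}(per_n) = rank KY_{p,n-1}(det_n)` over `ℂ` (both `C(n²,p)` resp. `C(n²,p+1)` for `p < n²`, both `0` for
`p ≥ n²`). For `n = 3`: the 18 cells `(p,0)`, `(p,2)` of the two 9-letter tables; for `n = 4`: the cells `(p,0)`, `(p,3)` of the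
16-letter tables (engine-3 `exact_det3/perm3`, `exact_det4/perm4`: equal there, as proved). [folklore] -/
def KYDetPerOuterColumns : Prop :=
  ∀ n p : ℕ, kyRank ℂ p 0 (perPoly (Fin n) ℂ) = kyRank ℂ p 0 (detPoly (Fin n) ℂ) ∧
    kyRank ℂ p (n - 1) (perPoly (Fin n) ℂ) = kyRank ℂ p (n - 1) (detPoly (Fin n) ℂ)

/-- `KYDetPerOuterColumns` holds. [folklore] -/
theorem kyDetPerOuterColumns_holds : KYDetPerOuterColumns := by
  intro n p
  by_cases hp : p + 1 ≤ n * n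
  · refine ⟨?_, ?_⟩
    · rw [kyRank_perPoly_zero ℂ n p hp, kyRank_detPoly_zero ℂ n p hp]
    · rw [kyRank_perPoly_top ℂ n p hp, kyRank_detPoly_top ℂ n p hp]
  · have hcard : Fintype.card (Fin n × Fin n) ≤ p := by simp; omega
    refine ⟨?_, ?_⟩ <;>
      rw [KYCone.kyRank_eq_zero_of_card_le _ p _ hcard, KYCone.kyRank_eq_zero_of_card_le _ p _ hcard]

/-- **The exact outer columns of the 9- and 16-letter tables** (`p + 1 ≤ n²`): `rank KY_{p,0} = C(n²,p)` and
`rank KY_{p,n-1} = C(n²,p+1)` for both `det_n` and `per_n` — e.g. `n = 3`: `1,9,36,84,126,126,84,36,9` (`k = 0`) and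
`9,36,84,126,126,84,36,9,1` (`k = 2`), the certified values of engine-3's exact tables (not in print). [folklore] -/
def KYDetPerOuterColumnValues : Prop :=
  ∀ n p : ℕ, p + 1 ≤ n * n →
    kyRank ℂ p 0 (detPoly (Fin n) ℂ) = (n * n).choose p ∧ kyRank ℂ p 0 (perPoly (Fin n) ℂ) = (n * n).choose p ∧
    kyRank ℂ p (n - 1) (detPoly (Fin n) ℂ) = (n * n).choose (p + 1) ∧
    kyRank ℂ p (n - 1) (perPoly (Fin n) ℂ) = (n * n).choose (p + 1)

/-- `KYDetPerOuterColumnValues` holds. [folklore] -/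
theorem kyDetPerOuterColumnValues_holds : KYDetPerOuterColumnValues := fun n p hp =>
  ⟨kyRank_detPoly_zero ℂ n p hp, kyRank_perPoly_zero ℂ n p hp, kyRank_detPoly_top ℂ n p hp,
    kyRank_perPoly_top ℂ n p hp⟩

/-- **The middle column of the 9-letter tables: `rank KY_{p,1}(per₃) ≤ rank KY_{p,1}(det₃)` for all `p`** — the 9 cells
`(p,1)`, `p ≤ 8`, of engine-3's exact tables `exact_det3.json` `04ea63a3e9cf73a7` / `exact_perm3.json` `7ca41ffc9cd62a0d`
(kyflat v0.6 `eaf7ff42f1dd`, two-sided certificates over `ℚ`, lead D208): equal `(9,80,315,720,·,720,315,80,9)` except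
`(4,1)`: `per₃ 934 < det₃ 950`; cells with `p ≥ 9` are `0 = 0`. A finite computation certified OUTSIDE Lean; an obligation node
until replayed in the kernel (engine-3's torus-weight blocking: `≤ 226` blocks of size `≤ 45` per cell). What remains of
`KYCubicsDominance` after this file. [folklore] -/
@[conjecture]
def KYCubicsMiddleColumnDominance : Prop :=
  ∀ p : ℕ, kyRank ℂ p 1 (perPoly (Fin 3) ℂ) ≤ kyRank ℂ p 1 (detPoly (Fin 3) ℂ)

/-- The reduction of the 9-letter table node to its middle column, as a named statement (shape α). [folklore] -/
def CubicsDominanceIffMiddleColumn : Prop :=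
  KYCubicsDominance ↔ KYCubicsMiddleColumnDominance

/-- **`KYCubicsDominance ↔ KYCubicsMiddleColumnDominance` holds**: the columns `k = 0` and `k = 2` are equal for `per₃` and
`det₃` (`KYDetPerOuterColumns`), and both tables vanish for `k ≥ 3` (degree `3`). [folklore] -/
theorem cubicsDominanceIffMiddleColumn_holds : CubicsDominanceIffMiddleColumn := by
  refine ⟨fun h p => h p 1, fun hmid p k => ?_⟩
  have hper3 : (perPoly (Fin 3) ℂ).IsHomogeneous 3 := by
    simpa only [Fintype.card_fin] using (perPoly_isHomogeneous : (perPoly (Fin 3) ℂ).IsHomogeneous _)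
  rcases k with _ | _ | _ | k
  · exact ((kyDetPerOuterColumns_holds 3 p).1).le
  · exact hmid p
  · exact ((kyDetPerOuterColumns_holds 3 p).2).le
  · rw [KYCone.kyRank_eq_zero_of_deg_le hper3 p (k + 3) (by omega)]
    exact Nat.zero_le _

/-- Consequently the C-F-1 edge of `KYPaddingTransport.lean` needs only the middle column:
`KYPaddingTransportLaw → KYCubicsMiddleColumnDominance → KYBlindPaddedPerThreeOwn`. [folklore] -/
def TransportMiddleImpliesBlindOwn : Prop :=
  KYPaddingTransportLaw → KYCubicsMiddleColumnDominance → KYBlindPaddedPerThreeOwn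

/-- `TransportMiddleImpliesBlindOwn` holds (compose `transportImpliesBlindOwn_holds` with the reduction). [folklore] -/
theorem transportMiddleImpliesBlindOwn_holds : TransportMiddleImpliesBlindOwn := fun hlaw hmid =>
  transportImpliesBlindOwn_holds hlaw (cubicsDominanceIffMiddleColumn_holds.2 hmid)

end Summit.PneNP.GCT
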